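import Mathlib.NumberTheory.LSeries.DirichletContinuation
import Mathlib.NumberTheory.LegendreSymbol.JacobiSymbol
import HarnessLib

/-!
# Prime values of a quadratic polynomial whose discriminant carries an exceptional character:
# `π_f(N) = A·V(A)·(1 + O(e^{−√β/6}))` (Chamizo–Jiménez-Urroz 2021, Theorem 1.1) — AS PRINTED

Topic `Literature/NumberTheory/LFunctions` (namespace `Literature.NumberTheory.LFunctions`; the
paper's objects in the sub-namespace `ChamizoJimenezUrroz2021`). STATEMENT LAYER (D-0014) typed for
the cell `parity-realchar` (SIEGEL INSTRUMENT, conditionals column Direction I, topic I.7 «prime values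
of quadratic polynomials (Bateman–Horn distortion) under an exceptional character»; the tree so far
only QUOTES this theorem inside the `scope_caveats` of
`Literature/Barriers/Parity/SiegelZeroQuadraticPolynomials.lean`) and cc `landau-siegel` (§C). It
is also the held, citable successor of Friedlander–Iwaniec, *Exceptional discriminants are the sum of
a square and a prime*, Q. J. Math. 64 (2013) 1099–1107 (doi:10.1093/qmath/has038 — NOT held,
paywalled, acquisition want filed 2026-08-27; the case `f(m) = D − m²` below): "in the second paper
it is proved that positive exceptional fundamental discriminants `D` can be written as `D = m² + p`
and that if `D` is 'exceptional enough' we have an asymptotic formula for the number of primes of the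
form `D − m²`. [...] Our goal in this paper is to adapt the techniques of [FrIw] to get a result valid
for every `f` as above when `Δ` is exceptional." (§1). Source: F. Chamizo, J. Jiménez-Urroz, *Primes
represented by quadratic polynomials via exceptional characters*, Arch. Math. 117 (2021) 147–154 =
arXiv:2011.05398 [ChamizoJimenezurroz2021], held (`paper:arxiv-2011.05398`), §§1–3 read.

## What the source prints (§1, verbatim)

"Let `f(x) = ax² + bx + c` be a quadratic polynomial with integer coefficients such that
`(a, b, c) = 1`, `a + b` or `c` odd and discriminant `Δ ≠ □`. [...] For each `N ≥ 1` we denote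
`π_f(N) = #{0 ≤ f(n) ≤ N : f(n) prime}` with `f` as before and for each integer `d`,
`ρ(d) = #{n : f(n) ≡ 0 (mod d)}`. Let `χ_Δ(n)` be the Kronecker character modulo `Δ`,
`χ_Δ(n) = (Δ/n)`. [...] We will denote `𝒜 = {f(n) ∈ [0,N] : n ∈ ℤ}` [...] and `A` [...] for [its]
cardinality. Also, we denote `V(x) = ∏_{p<x} (1 − p⁻¹ρ(p))`. The exceptionality of the character
`χ_Δ` will be measured by `β = −log(L(1, χ_Δ) log|Δ|)`. [...] To state our main result we introduce
the function `g(Δ) = Δ e^{−β/2}` if `Δ > 0`, `|Δ| (4|a| − e^{−β/2})⁻¹` if `Δ < 0`.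
**Theorem 1.1.** Let `1 ≤ |a| ≤ e^{β/5}` and `g(Δ) ≤ N ≤ |a||Δ|^{β/2}`. Then
`π_f(N) = A V(A)(1 + O(e^{−√β/6}))` with an absolute `O`-constant.
**Remark 1.2.** An asymptotic formula is obtained only under `β → +∞` or equivalently, under the
usual definition of exceptionality `L(1, χ_Δ) log|Δ| → 0`."

## How it is typed

* `f`, `A`, `π_f(N)` COUNT INTEGERS `n` (not values): §3, proof of Lemma 3.3 — "The inequalities
  `0 ≤ f(x) ≤ N` define one or two intervals for `x` [...] `X − 2 < A < X + 2`" with `X` their total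
  length; so `A = #{n ∈ ℤ : 0 ≤ f(n) ≤ N}` (`valueCount`) and
  `π_f(N) = #{n ∈ ℤ : 0 ≤ f(n) ≤ N, f(n) prime}` (`primeCount`), both finite (`Set.ncard`).
* `ρ(d)` = number of residues `n mod d` with `f(n) ≡ 0 (mod d)` (`rho`, via `Nat.card` on `ZMod d`);
  `V(x) = ∏_{p < x} (1 − ρ(p)/p)` over primes (`sievingProduct`).
* "the Kronecker character `χ_Δ = (Δ/·)` modulo `Δ`": any Dirichlet character mod `|Δ|` with the
  Kronecker values at the primes — `χ(p) = (Δ/p)` (Jacobi symbol) for odd primes `p` and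
  `χ(2) = 1, −1, 0` according as `Δ ≡ 1, 5 (mod 8)` or `Δ` even (a Dirichlet character is determined
  by its values at primes; this is the tree's convention of
  `Literature.NumberTheory.QuadraticFields.exists_kroneckerChar`). `Δ = b² − 4ac ≡ 0, 1 (mod 4)`
  need not be fundamental; `χ_Δ` may be imprimitive — exactly as in the source. `L(1, χ_Δ)` is real
  (`χ_Δ` is real-valued): rendered `(χ.LFunction 1).re`.
* "`(1 + O(e^{−√β/6}))` with an absolute `O`-constant": one `C` for all `f`, `N`, `χ`:
  `|π_f(N) − A V(A)| ≤ A·V(A)·C·e^{−√β/6}`. `|Δ|^{β/2}` is the real power. (For `β ≤ 0` the range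
  `1 ≤ |a| ≤ e^{β/5}` is empty and the statement void, as in print.)

## Contents

* defs `ChamizoJimenezUrroz2021.poly`, `.valueCount` (`A`), `.primeCount` (`π_f(N)`), `.rho`,
  `.sievingProduct` (`V`), `.IsKroneckerChar`, `.beta`, `.g`;
* NAMED FACT `chamizoJimenezUrroz2021_theorem11` (Theorem 1.1, unproved here);
* PROVED: `ChamizoJimenezUrroz2021.beta_nonneg_of_hyp` (the hypothesis `1 ≤ |a| ≤ e^{β/5}` forces
  `β ≥ 0`, so `√β` is the genuine square root).

LABEL (cell rule): instrument / statement layer. WHAT THIS IS NOT: no claim that an exceptional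
character exists (by Siegel's theorem `β ≤ ε log|Δ| + O_ε(1)`, ineffectively; Remark 1.2: an
asymptotic only along `L(1,χ_Δ) log|Δ| → 0`); nothing here bears on parity. No instances, no
notation, no axioms.

## References

* [ChamizoJimenezurroz2021] F. Chamizo, J. Jiménez-Urroz, Arch. Math. 117 (2021) 147–154 =
  arXiv:2011.05398: §1 (setting, Theorem 1.1, Remark 1.2), §3 Lemma 3.3 (the meaning of `A`).
* J. B. Friedlander, H. Iwaniec, *Exceptional discriminants are the sum of a square and a prime*,
  Q. J. Math. 64 (2013) 1099–1107 — the case `f(m) = D − m²` (not held; context only).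
* [Cox2013] §1.C (1.18) (the Kronecker symbol `(Δ/·)` as a character mod `|Δ|`).
-/

noncomputable section

open Complex Finset
open scoped Classical

namespace Literature.NumberTheory.LFunctions

namespace ChamizoJimenezUrroz2021

/-- `f(n) = a n² + b n + c`. [cite: ChamizoJimenezurroz2021, §1] -/
def poly (a b c : ℤ) (n : ℤ) : ℤ := a * n ^ 2 + b * n + c

/-- `A = #{n ∈ ℤ : 0 ≤ f(n) ≤ N}` (the cardinality of `𝒜 = {f(n) ∈ [0,N] : n ∈ ℤ}`, counted over
`n` — §3, proof of Lemma 3.3: `X − 2 < A < X + 2` with `X` the total length of the real solution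
intervals of `0 ≤ f(x) ≤ N`). [cite: ChamizoJimenezurroz2021, §1 and Lemma 3.3] -/
def valueCount (a b c : ℤ) (N : ℕ) : ℕ :=
  Set.ncard {n : ℤ | 0 ≤ poly a b c n ∧ poly a b c n ≤ N}

/-- `π_f(N) = #{0 ≤ f(n) ≤ N : f(n) prime}` (counted over `n`, like `A`).
[cite: ChamizoJimenezurroz2021, §1] -/
def primeCount (a b c : ℤ) (N : ℕ) : ℕ :=
  Set.ncard {n : ℤ | 0 ≤ poly a b c n ∧ poly a b c n ≤ N ∧ Prime (poly a b c n)}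

/-- `ρ(d) = #{n (mod d) : f(n) ≡ 0 (mod d)}`. [cite: ChamizoJimenezurroz2021, §1] -/
def rho (a b c : ℤ) (d : ℕ) : ℕ :=
  Nat.card {n : ZMod d // (a : ZMod d) * n ^ 2 + (b : ZMod d) * n + (c : ZMod d) = 0}

/-- `V(x) = ∏_{p < x} (1 − ρ(p)/p)` over the primes `p < x`.
[cite: ChamizoJimenezurroz2021, §1] -/
def sievingProduct (a b c : ℤ) (x : ℝ) : ℝ :=
  ∏ p ∈ (range ⌈x⌉₊).filter Nat.Prime, (1 - (rho a b c p : ℝ) / (p : ℝ))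

/-- "`χ_Δ(n) = (Δ/n)`, the Kronecker character modulo `Δ`": a Dirichlet character mod `D = |Δ|`
with the Kronecker values at the primes — `(Δ/p)` (Jacobi) at odd primes, and at `2` the value
`1, −1, 0` according as `Δ ≡ 1, 5 (mod 8)` or `Δ` is even (Cox (1.18); a Dirichlet character is
determined by its values at the primes). [cite: ChamizoJimenezurroz2021, §1] -/
def IsKroneckerChar (Δ : ℤ) {D : ℕ} [NeZero D] (χ : DirichletCharacter ℂ D) : Prop :=
  (D : ℤ) = |Δ| ∧
    (∀ p : ℕ, p.Prime → p ≠ 2 → χ (p : ZMod D) = (jacobiSym Δ p : ℂ)) ∧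
    χ (2 : ZMod D) = (if Δ % 8 = 1 then 1 else if Δ % 8 = 5 then -1 else 0)

/-- `β = −log(L(1, χ_Δ) log|Δ|)` — "the exceptionality of the character `χ_Δ`" (`L(1, χ_Δ)` is real).
[cite: ChamizoJimenezurroz2021, §1] -/
def beta (Δ : ℤ) {D : ℕ} [NeZero D] (χ : DirichletCharacter ℂ D) : ℝ :=
  -Real.log ((χ.LFunction 1).re * Real.log |(Δ : ℝ)|)

/-- `g(Δ) = Δ e^{−β/2}` if `Δ > 0`, `|Δ| (4|a| − e^{−β/2})⁻¹` if `Δ < 0` (the lower end of the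
`N`-range of Theorem 1.1). [cite: ChamizoJimenezurroz2021, §1] -/
def g (a Δ : ℤ) (β : ℝ) : ℝ :=
  if 0 < Δ then (Δ : ℝ) * Real.exp (-β / 2)
  else |(Δ : ℝ)| * (4 * |(a : ℝ)| - Real.exp (-β / 2))⁻¹

/-- Under `1 ≤ |a| ≤ e^{β/5}` one has `β ≥ 0` (so `√β` in Theorem 1.1 is a genuine square root).
[cite: ChamizoJimenezurroz2021, Theorem 1.1] -/
theorem beta_nonneg_of_hyp {a : ℤ} {β : ℝ} (h1 : 1 ≤ |a|) (h2 : (|a| : ℝ) ≤ Real.exp (β / 5)) :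
    0 ≤ β := by
  have h1' : (1 : ℝ) ≤ (|a| : ℝ) := by exact_mod_cast h1
  have : (1 : ℝ) ≤ Real.exp (β / 5) := le_trans h1' h2
  have h0 : 0 ≤ β / 5 := by
    by_contra hneg
    have hlt : Real.exp (β / 5) < 1 := Real.exp_lt_one_iff.mpr (lt_of_not_ge hneg)
    linarith
  linarith

end ChamizoJimenezUrroz2021

open ChamizoJimenezUrroz2021

/-- **Chamizo–Jiménez-Urroz 2021, Theorem 1.1 (NAMED FACT, as printed).** Setting (§1): `f(x) =
ax² + bx + c` with integer coefficients, `(a, b, c) = 1`, `a + b` or `c` odd, discriminant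
`Δ = b² − 4ac` not a square; `χ_Δ = (Δ/·)` the Kronecker character mod `|Δ|`,
`β = −log(L(1,χ_Δ) log|Δ|)`, `A = #{n : 0 ≤ f(n) ≤ N}`, `V(x) = ∏_{p<x}(1 − ρ(p)/p)`, `g(Δ)` as
above. "**Theorem 1.1.** Let `1 ≤ |a| ≤ e^{β/5}` and `g(Δ) ≤ N ≤ |a||Δ|^{β/2}`. Then
`π_f(N) = A V(A)(1 + O(e^{−√β/6}))` with an absolute `O`-constant." Rendered with one absolute `C`:
`|π_f(N) − A V(A)| ≤ A V(A)·C·e^{−√β/6}`. Contains Friedlander–Iwaniec's "exceptional discriminants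
are the sum of a square and a prime" (`f(m) = D − m²`, Q. J. Math. 2013) as the case the method is
adapted from. Unproved here (§§2–3: Buchstab's identity, the fundamental lemma, a 2-dimensional
upper-bound sieve and the lacunarity `δ(x) = Σ_{x≤p≤A} λ(p)/p` of `λ = 1 ∗ χ_Δ`).
[cite: ChamizoJimenezurroz2021, Theorem 1.1] -/
def chamizoJimenezUrroz2021_theorem11 : Prop :=
  ∃ C : ℝ, ∀ a b c : ℤ, Int.gcd (Int.gcd a b) c = 1 → (Odd (a + b) ∨ Odd c) →
    ¬ IsSquare (b ^ 2 - 4 * a * c) →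
    ∀ (D : ℕ) [NeZero D] (χ : DirichletCharacter ℂ D), IsKroneckerChar (b ^ 2 - 4 * a * c) χ →
      ∀ N : ℕ, 1 ≤ N →
        1 ≤ |a| → (|a| : ℝ) ≤ Real.exp (beta (b ^ 2 - 4 * a * c) χ / 5) →
        g a (b ^ 2 - 4 * a * c) (beta (b ^ 2 - 4 * a * c) χ) ≤ N →
        (N : ℝ) ≤ |(a : ℝ)| * (|(b ^ 2 - 4 * a * c : ℤ)| : ℝ) ^ (beta (b ^ 2 - 4 * a * c) χ / 2) →
          |(primeCount a b c N : ℝ) -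
              (valueCount a b c N : ℝ) * sievingProduct a b c (valueCount a b c N)| ≤
            (valueCount a b c N : ℝ) * sievingProduct a b c (valueCount a b c N) * C *
              Real.exp (-Real.sqrt (beta (b ^ 2 - 4 * a * c) χ) / 6)

end Literature.NumberTheory.LFunctions

end
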